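import Literature.Geometry.Riemannian.CutLocusBishopAssembly
import Literature.Geometry.Riemannian.ExpMapThm1034
import Literature.Geometry.Riemannian.CompactComplete
import HarnessLib

/-!
# The cut locus is closed: discharge of `cutLocus_isClosed_and_mem_of_two_le`

Final assembly of the proof of the named fact
`Literature.Geometry.Riemannian.cutLocus_isClosed_and_mem_of_two_le` of `CutLocusBishop.lean`
(J. M. Lee, *Introduction to Riemannian Manifolds*, 2nd ed. (2018), Thm. 10.34 (a): "The cut locus
of `p` is a closed subset of `M`", and Prop. 10.32 (a), for the metric cut locus of
`CutLocus.lean`). `CutLocusBishopAssembly.lean` proved the implication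
`lee_expMap_injectivityDomain → cutLocus_isClosed_and_mem_of_two_le`
(`cutLocus_isClosed_and_mem_of_two_le_of_injectivityDomain`), and `ExpMapThm1034.lean` discharged
`lee_expMap_injectivityDomain` (`lee_expMap_injectivityDomain_holds`, Lee Thm. 10.34 (b),(c) through
Jacobi fields and the index form); this file combines the two. It lives apart from
`CutLocusBishop.lean` because the proof files import that file.

Also recorded, for consumers working with a metric of smoothness `n ≥ ∞` (in particular real-analytic
metrics, `n = ω`, as in Buchner 1977) rather than with the `C^∞` packaging of the named fact:

* `isClosed_cutLocus` — the metric cut locus of a point of a connected boundaryless Riemannian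
  manifold with geodesically complete Levi-Civita connection is closed (Lee, Thm. 10.34 (a));
* `isClosed_cutLocus_of_compactSpace`, `isCompact_cutLocus_of_compactSpace` — the compact case, all
  standing instances supplied (Levi-Civita connection by `hasLeviCivita`, its regularity by
  `isLocallyContMDiff_leviCivita_holds`, completeness by O'Neill 1983, Ch. 5, Cor. 23,
  `isGeodesicallyComplete_of_compactSpace`).

No definitions and no new named facts (D-0026); net debt `-1`.

## References

* J. M. Lee, *Introduction to Riemannian Manifolds*, 2nd ed., GTM 176 (2018), Prop. 10.32 (a),
  Thm. 10.34 (a)–(c) (pp. 308–311). [LeeRiemannianManifolds2018]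
* B. O'Neill, *Semi-Riemannian Geometry* (1983), Ch. 5, Cor. 23. [ONeill1983]
* M. A. Buchner, *Simplicial structure of the real analytic cut locus*, Proc. AMS 64 (1977)
  118–121 (consumer: compactness of the cut locus of a compact analytic manifold).
  [Buchner1977Simplicial]
-/

noncomputable section

open Bundle Set Filter Function Manifold
open scoped Manifold ContDiff Topology ENNReal NNReal

namespace Literature.Geometry.Riemannian

open Literature.Geometry.Lorentzian
open Literature.Geometry.Lorentzian.PseudoRiemannianMetric

/-- **Lee 2018, Thm. 10.34 (a) and Prop. 10.32 (a)** — discharge of the named fact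
`cutLocus_isClosed_and_mem_of_two_le`: on a connected boundaryless `C^∞` Riemannian manifold whose
closed distance balls are compact, the cut locus of every point `p` is closed, and every point
joined to `p` by at least two distinct minimal geodesics is a cut point of `p`. Immediate from
`cutLocus_isClosed_and_mem_of_two_le_of_injectivityDomain` (`CutLocusBishopAssembly.lean`) and
`lee_expMap_injectivityDomain_holds` (`ExpMapThm1034.lean`).
[cite: LeeRiemannianManifolds2018, Thm. 10.34 (a) and Prop. 10.32 (a)] -/
theorem cutLocus_isClosed_and_mem_of_two_le_holds : cutLocus_isClosed_and_mem_of_two_le :=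
  cutLocus_isClosed_and_mem_of_two_le_of_injectivityDomain lee_expMap_injectivityDomain_holds

section General

variable {E : Type*} [NormedAddCommGroup E] [NormedSpace ℝ E] {H : Type*} [TopologicalSpace H]
  {I : ModelWithCorners ℝ E H} {M : Type*} [TopologicalSpace M] [ChartedSpace H M]
  [IsManifold I ∞ M] {n : ℕ∞ω} [FiniteDimensional ℝ E] [CompleteSpace E] [T2Space M]
  [BoundarylessManifold I M] [ConnectedSpace M]
  (g : PseudoRiemannianMetric I n E (TangentSpace I : M → Type _)) [g.HasLeviCivita]
  [CovariantDerivative.ContMDiffCovariantDerivative g.leviCivita 1]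

/-- **The cut locus is closed** (Lee 2018, Thm. 10.34 (a)), for a Riemannian metric of any
smoothness `n ≥ ∞` (e.g. real-analytic) on a connected Hausdorff manifold without boundary whose
Levi-Civita connection is geodesically complete: `isClosed_cutLocus_of_injective_mfderiv`
(`CutTimeSemicontinuity.lean`, Thm. 10.33/10.34 (a) granted no critical points of `exp_p` in the
injectivity domain) fed with the last clause of `lee_expMap_injectivityDomain_holds`
(Thm. 10.34 (c)). [cite: LeeRiemannianManifolds2018, Thm. 10.34 (a)] -/
theorem isClosed_cutLocus (hn : (∞ : ℕ∞ω) ≤ n) (hg : g.IsRiemannian)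
    (hc : IsGeodesicallyComplete g.leviCivita) (p : M) : IsClosed (cutLocus g hg p) := by
  refine isClosed_cutLocus_of_injective_mfderiv g hn hg hc p fun u s hs hmin ↦ ?_
  obtain ⟨-, -, -, -, hbij⟩ := lee_expMap_injectivityDomain_holds hn g hg hc p
  exact (hbij (show TangentSpace I p from u) ⟨s, hs, hmin⟩).1

end General

section Compact

variable {E : Type*} [NormedAddCommGroup E] [NormedSpace ℝ E] [FiniteDimensional ℝ E]
  {H : Type*} [TopologicalSpace H] {I : ModelWithCorners ℝ E H}
  {M : Type*} [TopologicalSpace M] [ChartedSpace H M] [IsManifold I ∞ M]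
  [CompactSpace M] [T2Space M] [ConnectedSpace M] [BoundarylessManifold I M] {n : ℕ∞ω}
  (g : PseudoRiemannianMetric I n E (TangentSpace I : M → Type _))

/-- **The cut locus of a point of a compact Riemannian manifold is closed** (Lee 2018,
Thm. 10.34 (a); the form used by Buchner 1977 for compact real-analytic manifolds, `n = ω`): the
instance-free packaging of `isClosed_cutLocus` for a metric of smoothness `n ≥ ∞` on a compact
connected Hausdorff manifold without boundary — the Levi-Civita connection exists
(`hasLeviCivita`), is `C¹` (`isLocallyContMDiff_leviCivita_holds`) and is geodesically complete
(O'Neill 1983, Ch. 5, Cor. 23, `isGeodesicallyComplete_of_compactSpace`).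
[cite: LeeRiemannianManifolds2018, Thm. 10.34 (a)] -/
theorem isClosed_cutLocus_of_compactSpace (hn : (∞ : ℕ∞ω) ≤ n) (hg : g.IsRiemannian) (p : M) :
    IsClosed (cutLocus g hg p) := by
  haveI : CompleteSpace E := FiniteDimensional.complete ℝ E
  have h1 : (1 : ℕ∞ω) ≤ n := le_trans (by exact_mod_cast le_top) hn
  haveI : Fact (1 ≤ n) := ⟨h1⟩
  haveI : g.HasLeviCivita := g.hasLeviCivita
  haveI : CovariantDerivative.ContMDiffCovariantDerivative g.leviCivita 1 :=
    ⟨g.isLocallyContMDiff_leviCivita_holds 1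
      (le_trans (by exact_mod_cast le_top) hn) univ isOpen_univ⟩
  have h2 : (2 : ℕ∞ω) ≤ n :=
    le_trans (show ((2 : ℕ∞) : ℕ∞ω) ≤ ((⊤ : ℕ∞) : ℕ∞ω) from WithTop.coe_le_coe.2 le_top) hn
  have hc : IsGeodesicallyComplete g.leviCivita := g.isGeodesicallyComplete_of_compactSpace h2 hg
  exact isClosed_cutLocus g hn hg hc p

/-- **The cut locus of a point of a compact Riemannian manifold is compact** (closed subset of a
compact space; Lee 2018, Thm. 10.34 (a)). [cite: LeeRiemannianManifolds2018, Thm. 10.34 (a)] -/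
theorem isCompact_cutLocus_of_compactSpace (hn : (∞ : ℕ∞ω) ≤ n) (hg : g.IsRiemannian) (p : M) :
    IsCompact (cutLocus g hg p) :=
  (isClosed_cutLocus_of_compactSpace g hn hg p).isCompact

end Compact

end Literature.Geometry.Riemannian

end
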